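import Summits.Ventures.PercRepro.S1FiveCircuitX2C

/-!
# PercRepro — LEMMA X⁺⁺, part 1: the four-circuit exclusions on the independent `4`-sets (p2, gen 18)

One more family of excluded points on the INDEPENDENT `4`-sets `Q`: a point `e ∉ Q` lying on a four-circuit whose other
three points are in `Q`. It lies in `cl Q ∖ Q`, it is the fifth point of no five-circuit through `Q` (the four-circuit
would sit inside), and it is NOT a third point of a triangle on a pair of `Q` — by circuit elimination the triangle and
the four-circuit, both through `e`, would leave a circuit inside `Q`, against independence. So for independent `Q` the
charge is `#{C ⊇ Q} + #excl(Q) + #excl₂(Q) ≤ 6`. Part 2 (`S1FiveCircuitX3B`) counts the new exclusions and assembles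
LEMMA X⁺⁺.

* `excl2 M Q` — the fourth points of four-circuits on triples of `Q`, outside `Q`;
* `card_fifth_add_card_excl_add_le` — the charge with `excl₂` on the independent `4`-sets.
Axioms: standard.
-/

open scoped Matroid

namespace PercRepro

namespace S1

open Set

variable {α : Type}

open Classical in
/-- `excl2 M Q`: the points of `E` outside `Q` lying on a four-circuit whose other three points are in `Q`. -/
noncomputable def excl2 (M : Matroid α) [M.Finite] (Q : Finset α) : Finset α :=
  M.ground_finite.toFinset.filter
    (fun e => e ∉ Q ∧ ∃ D ∈ fourCircuits M, e ∈ D ∧ D \ {e} ⊆ ((Q : Finset α) : Set α))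

/-- Membership in `excl2`. -/
theorem mem_excl2 (M : Matroid α) [M.Finite] {Q : Finset α} {e : α} :
    e ∈ excl2 M Q ↔ e ∈ M.E ∧ e ∉ Q ∧ ∃ D ∈ fourCircuits M, e ∈ D ∧ D \ {e} ⊆ ((Q : Finset α) : Set α) := by
  simp only [excl2, Finset.mem_filter, Set.Finite.mem_toFinset]

open Classical in
/-- **The charge of a `4`-set, with the four-circuit exclusions on the independent ones**:
`#fifth(Q) + #excl(Q) + (if Q independent then #excl₂(Q) else 4) ≤ 6` (under (C2), (C3)). -/
theorem card_fifth_add_card_excl_add_le (M : Matroid α) [M.Finite]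
    (hC2 : ∀ P ⊆ M.E, M.eRk P ≤ 3 → P.ncard ≤ 6) (hC3 : ∀ X ⊆ M.E, M.eRk X ≤ 4 → X.ncard ≤ 10)
    {Q : Finset α} (hQ : Q ∈ M.ground_finite.toFinset.powersetCard 4) :
    (fifth M Q).card + (excl M Q).card +
      (if M.Indep ((Q : Finset α) : Set α) then (excl2 M Q).card else 4) ≤ 6 := by
  classical
  have hX := card_fifth_add_card_excl_le M hC2 hC3 hQ
  split_ifs with hind
  · rw [if_pos hind, mul_zero, add_zero] at hX
    rw [Finset.mem_powersetCard] at hQ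
    obtain ⟨hQE, hQ4⟩ := hQ
    have hQE' : ((Q : Finset α) : Set α) ⊆ M.E := Set.Finite.subset_toFinset.1 hQE
    have hQfin : ((Q : Finset α) : Set α).Finite := Q.finite_toSet
    have hQn : ((Q : Finset α) : Set α).ncard = 4 := by rw [Set.ncard_coe_finset, hQ4]
    have hclE : M.closure ((Q : Finset α) : Set α) ⊆ M.E := M.closure_subset_ground _
    have hclfin : (M.closure ((Q : Finset α) : Set α)).Finite := M.ground_finite.subset hclE
    have hXcl : ((Q : Finset α) : Set α) ⊆ M.closure ((Q : Finset α) : Set α) := M.subset_closure _ hQE'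
    have hDfin : (M.closure ((Q : Finset α) : Set α) \ ↑Q).Finite := hclfin.subset Set.sdiff_subset
    have hencard : ((Q : Finset α) : Set α).encard = 4 := by
      rw [← hQfin.cast_ncard_eq, hQn]
      rfl
    have hD6 : (M.closure ((Q : Finset α) : Set α) \ ↑Q).ncard ≤ 6 := by
      have hr : M.eRk (M.closure ((Q : Finset α) : Set α)) ≤ 4 := by
        rw [M.eRk_closure_eq]
        exact (M.eRk_le_encard _).trans (le_of_eq hencard)
      have := hC3 _ hclE hr
      rw [Set.ncard_sdiff' hXcl hclfin, hQn]
      omega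
    -- the three families inside `cl Q ∖ Q`
    have hexclD : excl M Q ⊆ hDfin.toFinset := by
      intro e he
      rw [mem_excl] at he
      obtain ⟨_, heQ, T, hT, heT, hTQ⟩ := he
      rw [Set.Finite.mem_toFinset]
      refine ⟨?_, heQ⟩
      have h := hT.1.mem_closure_sdiff_singleton_of_mem heT
      exact M.closure_subset_closure hTQ h
    have hexcl2D : excl2 M Q ⊆ hDfin.toFinset := by
      intro e he
      rw [mem_excl2] at he
      obtain ⟨_, heQ, D, hD, heD, hDQ⟩ := he
      rw [Set.Finite.mem_toFinset]
      refine ⟨?_, heQ⟩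
      have h := hD.1.mem_closure_sdiff_singleton_of_mem heD
      exact M.closure_subset_closure hDQ h
    -- `excl` and `excl₂` are disjoint on an independent `4`-set: circuit elimination
    have hdisj : Disjoint (excl M Q) (excl2 M Q) := by
      rw [Finset.disjoint_left]
      intro e he he2
      rw [mem_excl] at he
      rw [mem_excl2] at he2
      obtain ⟨-, -, T, hT, heT, hTQ⟩ := he
      obtain ⟨-, -, D, hD, heD, hDQ⟩ := he2
      have hne : T ≠ D := by
        intro h
        have h3 := hT.2
        rw [h, hD.2] at h3
        omega
      obtain ⟨C, hCsub, hCc⟩ := hT.1.elimination hD.1 hne e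
      have hCQ : C ⊆ ((Q : Finset α) : Set α) := by
        intro z hz
        have hz' := hCsub hz
        obtain ⟨hz1, hz2⟩ := hz'
        rcases hz1 with hzT | hzD
        · exact hTQ ⟨hzT, hz2⟩
        · exact hDQ ⟨hzD, hz2⟩
      exact hCc.dep.not_indep (hind.subset hCQ)
    -- the fifth points avoid both families
    have hfifth : (fifth M Q).card ≤ (hDfin.toFinset \ (excl M Q ∪ excl2 M Q)).card := by
      refine Finset.card_le_card_of_surjOn (fun f => insert f ((Q : Finset α) : Set α)) ?_
      intro C hC
      rw [Finset.mem_coe, mem_fifth] at hC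
      obtain ⟨⟨hCc, hC5⟩, hQC⟩ := hC
      have hCfin : C.Finite := M.ground_finite.subset hCc.subset_ground
      obtain ⟨f, hfC, hfQ⟩ : ∃ f, f ∈ C ∧ f ∉ ((Q : Finset α) : Set α) :=
        Set.exists_mem_notMem_of_ncard_lt_ncard (by rw [hQn, hC5]; norm_num) hQfin
      have hCeq : insert f ((Q : Finset α) : Set α) = C := by
        refine Set.eq_of_subset_of_ncard_le (Set.insert_subset hfC hQC) ?_ hCfin
        rw [hC5, Set.ncard_insert_of_notMem hfQ hQfin, hQn]
      refine ⟨f, ?_, hCeq⟩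
      rw [Finset.mem_coe, Finset.mem_sdiff, Set.Finite.mem_toFinset, Finset.mem_union]
      refine ⟨⟨?_, hfQ⟩, ?_⟩
      · have h := hCc.mem_closure_sdiff_singleton_of_mem hfC
        refine M.closure_subset_closure ?_ h
        intro z hz
        rw [← hCeq] at hz
        obtain ⟨hz1, hz2⟩ := hz
        rcases hz1 with rfl | hz1
        · exact (hz2 (Set.mem_singleton _)).elim
        · exact hz1
      · rintro (hf | hf)
        · rw [mem_excl] at hf
          obtain ⟨-, -, T, hT, hfT, hTQ⟩ := hf
          have hTC : T ⊆ C := by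
            intro z hz
            by_cases hzf : z = f
            · rw [hzf]; exact hfC
            · exact hQC (hTQ ⟨hz, hzf⟩)
          have hTC' : T ⊂ C := hTC.ssubset_of_ne (by
            intro h
            have h3 := hT.2
            rw [h, hC5] at h3
            omega)
          exact hT.1.dep.not_indep (hCc.ssubset_indep hTC')
        · rw [mem_excl2] at hf
          obtain ⟨-, -, D, hD, hfD, hDQ⟩ := hf
          have hDC : D ⊆ C := by
            intro z hz
            by_cases hzf : z = f
            · rw [hzf]; exact hfC
            · exact hQC (hDQ ⟨hz, hzf⟩)
          have hDC' : D ⊂ C := hDC.ssubset_of_ne (by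
            intro h
            have h4 := hD.2
            rw [h, hC5] at h4
            omega)
          exact hD.1.dep.not_indep (hCc.ssubset_indep hDC')
    have hunion : excl M Q ∪ excl2 M Q ⊆ hDfin.toFinset := Finset.union_subset hexclD hexcl2D
    have hsplit := Finset.card_sdiff_add_card_eq_card hunion
    have hcardU : (excl M Q ∪ excl2 M Q).card = (excl M Q).card + (excl2 M Q).card :=
      Finset.card_union_eq_card_add_card.2 hdisj
    have hDcard : hDfin.toFinset.card = (M.closure ((Q : Finset α) : Set α) \ ↑Q).ncard :=
      (Set.ncard_eq_toFinset_card _ _).symm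
    omega
  · rw [if_neg hind, mul_one] at hX
    exact hX

end S1

end PercRepro
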